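import Mathlib
import HarnessLib
import Summits.HubbardSuperconductivity.HubbardSuperconductivity.Theorems.KLProgrammeC4aUmkNumerator

/-!
# Route `KLProgramme` — crux C4a, S3 brick (B4) «(U1)-HYBRID» part D-3a: THE MIXED COOPER DEFECT — the loop-angle derivative of the anisotropy defect
# `∂_φ𝒜_φ = ∂_φ De_K(S − Φ(e,φ+θ))[S′ − ∂_sΦ(e,φ+θ)]` vanishes at exact nesting and is `≤ K₂msD₁‖S′‖ + (K₃msD₁² + K₂msD₂)‖S‖` in general

Cell `gate-hubbard-kl`, seat hubbard-kl-k3c3-p3 (g36; row «implicit-function / monotonicity route for μ(n)»).  Located brick for the (C)-closer lane / the (M4)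
assembly of the first-order ϑ-layer (stub (C) `stub_twoLeg_curvature` of `KLRegimeEngineV17F2`, stmt-HubbardSuperconductivity-20437), memo
HOME/hubbard-kl-k3c3-p3/U1-CAUSTIC-SUP.md §19 (D-3: the near-Cooper ratio-form key lemma needs «Cooper-defect ceilings ∝ s INCLUDING ONE MIXED DERIVATIVE», B4-DIRECT-COUNT §1 (iii)).

WHY.  The near-(C) instance of `…C4aTransversalZeroControl.abs_le_mul_abs_of_transversal_zeros_deriv` controls `h = 𝒜_φ(0,·)` by `f = ē(0,·)`; its row `|h′| ≤ H₁`
must scale with the Cooper distance `s` (like the slopes `σ ≍ η` of `f`) for the ratio `H₁/σ` to be `η`-free.  With `S, S′` the (fixed) pair momentum and its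
base-angle velocity and `γ(φ) = Φ(e, φ+θ)`:  `𝒜_φ(φ) = De_K(S − γ(φ))[S′ − γ′(φ)]` (c4a-1 `hasDerivAt_partnerBand_pp_base`), hence
`∂_φ𝒜_φ = D²e_K(P)[−γ′, S′ − γ′] − De_K(P)[γ″]`, and at exact nesting (`S = S′ = 0`, `P = −γ`) this is `(e_K ∘ (−γ))″ = 0` (`e_K(−Φ(e,·)) ≡ e`).  Subtracting the
reference and using the Lipschitz bounds of `De_K` (`K₂`) and `D²e_K` (`K₃`): `|∂_φ𝒜_φ| ≤ K₂‖γ′‖‖S′‖ + (K₃‖γ′‖² + K₂‖γ″‖)‖S‖`.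
* `hasDerivAt_fderiv_comp_apply` — the derivative of `φ ↦ Df(P(φ))[w(φ)]` (carrier-free);
* `fderiv_fderiv_ref_apply_eq_zero` — the reference identity `D²f(−γ)[γ′,γ′] − Df(−γ)[γ″] = 0` when `f(−γ) ≡ e`;
* **`abs_deriv_anisotropy_le_cooper`** (carrier-free sizes form).  The pp instance (`γ φ := Φ(e,φ+θ)`, `href` = `frameLevel_neg_levelPoint_tube`, `m₁ = msD₁`,
  `m₂ = msD₂`, `‖S‖, ‖S′‖ ≲ |ρ| + |ϑ − π|` by `…C4aPathRigidity`) is the successor's one-call corollary (memo §19, D-3).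
Sizes binder shape; pure calculus on landed objects; nothing asserts (C), K3 or superconductivity.
References: FST II CPAM 51 (1998) §3 Thm 3.5 [cite: FeldmanSalmhoferTrubowitz1998]; BGM 2006 §2.4 [cite: BenfattoGiulianiMastropietro2006].
-/

noncomputable section

namespace Summit.HubbardSuperconductivity.HubbardSuperconductivity.Theorems.C4a

set_option linter.dupNamespace false -- summit = problem name (single-conjunct summit), D-0017

open Real Set Filter
open scoped Topology
open Literature.MathematicalPhysics.QuantumLattice Literature.MathematicalPhysics.QuantumLattice.BandSectorCounting Literature.Probability.LatticeModels
open Summit.HubbardSuperconductivity.HubbardSuperconductivity.Theorems.KLRegimeSplit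
open Summit.HubbardSuperconductivity.HubbardSuperconductivity.Theorems.DispersionFlow
open Summit.HubbardSuperconductivity.HubbardSuperconductivity.Theorems.PerturbedFermiCurve

/-! ## §1 Carrier-free calculus -/

section Abstract

variable {V : Type*} [NormedAddCommGroup V] [NormedSpace ℝ V]

/-- **Derivative of `φ ↦ Df(P(φ))[w(φ)]`**: `D²f(P)[P′](w) + Df(P)[w′]` (`f ∈ C²`, `P, w` differentiable at `φ`). [folklore] -/
theorem hasDerivAt_fderiv_comp_apply {f : V → ℝ} (hf : ContDiff ℝ 2 f) {P w : ℝ → V} {P' w' : V} {φ : ℝ} (hP : HasDerivAt P P' φ)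
    (hw : HasDerivAt w w' φ) :
    HasDerivAt (fun x : ℝ => (fderiv ℝ f (P x)) (w x)) ((fderiv ℝ (fderiv ℝ f) (P φ) P') (w φ) + (fderiv ℝ f (P φ)) w') φ := by
  have hD : Differentiable ℝ (fderiv ℝ f) := (hf.fderiv_right (m := 1) (by norm_num)).differentiable one_ne_zero
  have h1 : HasDerivAt (fun x : ℝ => fderiv ℝ f (P x)) ((fderiv ℝ (fderiv ℝ f) (P φ)) P') φ := (hD _).hasFDerivAt.comp_hasDerivAt φ hP
  have h := h1.clm_apply hw
  convert h using 1

/-- **The reference identity at exact nesting**: if `f(−γ(x)) = e` for all `x` (`f ∈ C²`, `γ ∈ C²`), then `D²f(−γ(φ))[γ′(φ)](γ′(φ)) − Df(−γ(φ))[γ″(φ)] = 0`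
(the second derivative of the constant function `f ∘ (−γ)`, computed by the chain rule). [folklore] -/
theorem fderiv_fderiv_ref_apply_eq_zero {f : V → ℝ} (hf : ContDiff ℝ 2 f) {γ : ℝ → V} (hγ : ContDiff ℝ 2 γ) {e : ℝ} (href : ∀ x, f (-γ x) = e) (φ : ℝ) :
    (fderiv ℝ (fderiv ℝ f) (-γ φ) (deriv γ φ)) (deriv γ φ) - (fderiv ℝ f (-γ φ)) (iteratedDeriv 2 γ φ) = 0 := by
  have hγd : ∀ x, HasDerivAt γ (deriv γ x) x := fun x => ((hγ.differentiable (by norm_num)) x).hasDerivAt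
  have hγ'd : HasDerivAt (deriv γ) (iteratedDeriv 2 γ φ) φ := by
    have h1 : ContDiff ℝ 1 (deriv γ) := by
      have := hγ.iterate_deriv' 1 1; simpa using this
    have := ((h1.differentiable (by norm_num)) φ).hasDerivAt
    rw [iteratedDeriv_succ, iteratedDeriv_one]; exact this
  -- g₁(x) := Df(−γ x)[−γ′ x] is the derivative of the constant `x ↦ f(−γ x)`, hence ≡ 0
  have hfd : ∀ y, HasFDerivAt f (fderiv ℝ f y) y := fun y => ((hf.differentiable (by norm_num)) y).hasFDerivAt
  have hg₁ : ∀ x, (fderiv ℝ f (-γ x)) (-deriv γ x) = 0 := by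
    intro x
    have hcomp : HasDerivAt (fun x => f (-γ x)) ((fderiv ℝ f (-γ x)) (-deriv γ x)) x := (hfd _).comp_hasDerivAt x (hγd x).neg
    have hconst : HasDerivAt (fun x => f (-γ x)) 0 x := by
      have : (fun x => f (-γ x)) = fun _ => e := funext href
      rw [this]; exact hasDerivAt_const x e
    exact hcomp.unique hconst
  -- differentiate g₁ ≡ 0
  have hP : HasDerivAt (fun x => -γ x) (-deriv γ φ) φ := (hγd φ).neg
  have hw : HasDerivAt (fun x => -deriv γ x) (-iteratedDeriv 2 γ φ) φ := hγ'd.neg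
  have hder := hasDerivAt_fderiv_comp_apply hf hP hw
  have hzero : HasDerivAt (fun x : ℝ => (fderiv ℝ f (-γ x)) (-deriv γ x)) 0 φ := by
    have : (fun x : ℝ => (fderiv ℝ f (-γ x)) (-deriv γ x)) = fun _ => (0 : ℝ) := funext hg₁
    rw [this]; exact hasDerivAt_const φ (0 : ℝ)
  have heq := hder.unique hzero
  -- massage: D²f(−γ)[−γ′](−γ′) = D²f(−γ)[γ′](γ′)
  have h2 : (fderiv ℝ (fderiv ℝ f) (-γ φ) (-deriv γ φ)) (-deriv γ φ) = (fderiv ℝ (fderiv ℝ f) (-γ φ) (deriv γ φ)) (deriv γ φ) := by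
    simp only [map_neg, neg_neg, neg_apply]
  rw [h2, map_neg] at heq
  linarith [heq]

/-- **THE MIXED DEFECT, CARRIER-FREE**: `f ∈ C³` with `‖Df‖ ≤ K₁`, `‖D²f‖ ≤ K₂`, `‖D³f‖ ≤ K₃`; `γ ∈ C²` with `f(−γ) ≡ e`, `‖γ′(φ)‖ ≤ m₁`, `‖γ″(φ)‖ ≤ m₂`; fixed `S, S′`
with `‖S‖ ≤ s₀`, `‖S′‖ ≤ s₁`.  Then `|∂_φ De_K… | = |d/dφ Df(S − γ(φ))[S′ − γ′(φ)]| ≤ K₂m₁s₁ + (K₃m₁² + K₂m₂)s₀`. -/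
theorem abs_deriv_anisotropy_le_cooper {f : V → ℝ} (hf : ContDiff ℝ 3 f) {K₂ K₃ : ℝ} (hK₂ : ∀ x, ‖iteratedFDeriv ℝ 2 f x‖ ≤ K₂)
    (hK₃ : ∀ x, ‖iteratedFDeriv ℝ 3 f x‖ ≤ K₃) {γ : ℝ → V} (hγ : ContDiff ℝ 2 γ) {e : ℝ} (href : ∀ x, f (-γ x) = e) (S Sp : V) {s₀ s₁ m₁ m₂ : ℝ}
    (hs₀ : ‖S‖ ≤ s₀) (hs₁ : ‖Sp‖ ≤ s₁) {φ : ℝ} (hm₁ : ‖deriv γ φ‖ ≤ m₁) (hm₂ : ‖iteratedDeriv 2 γ φ‖ ≤ m₂) :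
    |deriv (fun x : ℝ => (fderiv ℝ f (S - γ x)) (Sp - deriv γ x)) φ| ≤ K₂ * m₁ * s₁ + (K₃ * m₁ ^ 2 + K₂ * m₂) * s₀ := by
  have hf2 : ContDiff ℝ 2 f := hf.of_le (by norm_num)
  have hγd : ∀ x, HasDerivAt γ (deriv γ x) x := fun x => ((hγ.differentiable (by norm_num)) x).hasDerivAt
  have hγ'd : HasDerivAt (deriv γ) (iteratedDeriv 2 γ φ) φ := by
    have h1 : ContDiff ℝ 1 (deriv γ) := by
      have := hγ.iterate_deriv' 1 1; simpa using this
    have := ((h1.differentiable (by norm_num)) φ).hasDerivAt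
    rw [iteratedDeriv_succ, iteratedDeriv_one]; exact this
  have hP : HasDerivAt (fun x => S - γ x) (-deriv γ φ) φ := (hγd φ).const_sub S
  have hw : HasDerivAt (fun x => Sp - deriv γ x) (-iteratedDeriv 2 γ φ) φ := hγ'd.const_sub Sp
  have hder := hasDerivAt_fderiv_comp_apply hf2 hP hw
  rw [hder.deriv]
  have href0 := fderiv_fderiv_ref_apply_eq_zero hf2 hγ href φ
  -- sizes
  have hK₂0 : 0 ≤ K₂ := (norm_nonneg _).trans (hK₂ 0)
  have hK₃0 : 0 ≤ K₃ := (norm_nonneg _).trans (hK₃ 0)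
  have hm₁0 : 0 ≤ m₁ := (norm_nonneg _).trans hm₁
  have hs₀0 : 0 ≤ s₀ := (norm_nonneg _).trans hs₀
  set P := S - γ φ with hPdef
  set g1 := deriv γ φ with hg1
  set g2 := iteratedDeriv 2 γ φ with hg2
  have hPQ : ‖P - (-γ φ)‖ ≤ s₀ := by rw [hPdef, sub_neg_eq_add, sub_add_cancel]; exact hs₀
  -- operator-norm facts
  have hB2 : ∀ x (u v : V), |(fderiv ℝ (fderiv ℝ f) x u) v| ≤ K₂ * ‖u‖ * ‖v‖ := by
    intro x u v
    rw [← Real.norm_eq_abs]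
    have h1 : ‖fderiv ℝ (fderiv ℝ f) x u‖ ≤ K₂ * ‖u‖ := by
      refine (ContinuousLinearMap.le_opNorm _ _).trans (mul_le_mul_of_nonneg_right ?_ (norm_nonneg _))
      rw [norm_fderiv_two_eq_norm_iteratedFDeriv]; exact hK₂ x
    exact (ContinuousLinearMap.le_opNorm _ _).trans (mul_le_mul_of_nonneg_right h1 (norm_nonneg _))
  have hB2L : ∀ x y (u v : V), |(fderiv ℝ (fderiv ℝ f) x u) v - (fderiv ℝ (fderiv ℝ f) y u) v| ≤ K₃ * ‖x - y‖ * ‖u‖ * ‖v‖ := by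
    intro x y u v
    have hD : Differentiable ℝ (fderiv ℝ (fderiv ℝ f)) :=
      ((hf.fderiv_right (m := 2) (by norm_num)).fderiv_right (m := 1) (by norm_num)).differentiable one_ne_zero
    have hLip : ‖fderiv ℝ (fderiv ℝ f) x - fderiv ℝ (fderiv ℝ f) y‖ ≤ K₃ * ‖x - y‖ :=
      Convex.norm_image_sub_le_of_norm_fderiv_le (𝕜 := ℝ) (f := fderiv ℝ (fderiv ℝ f)) (fun z _ => hD z)
        (fun z _ => by rw [norm_fderiv_three_eq_norm_iteratedFDeriv]; exact hK₃ z) convex_univ (mem_univ y) (mem_univ x)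
    have h : (fderiv ℝ (fderiv ℝ f) x u) v - (fderiv ℝ (fderiv ℝ f) y u) v = ((fderiv ℝ (fderiv ℝ f) x - fderiv ℝ (fderiv ℝ f) y) u) v := rfl
    rw [h, ← Real.norm_eq_abs]
    refine (ContinuousLinearMap.le_opNorm _ _).trans (mul_le_mul_of_nonneg_right ?_ (norm_nonneg _))
    exact (ContinuousLinearMap.le_opNorm _ _).trans (mul_le_mul_of_nonneg_right hLip (norm_nonneg _))
  have hB1L : ∀ x y (u : V), |(fderiv ℝ f x) u - (fderiv ℝ f y) u| ≤ K₂ * ‖x - y‖ * ‖u‖ := by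
    intro x y u
    have hD : Differentiable ℝ (fderiv ℝ f) := (hf2.fderiv_right (m := 1) (by norm_num)).differentiable one_ne_zero
    have hLip : ‖fderiv ℝ f x - fderiv ℝ f y‖ ≤ K₂ * ‖x - y‖ :=
      Convex.norm_image_sub_le_of_norm_fderiv_le (𝕜 := ℝ) (f := fderiv ℝ f) (fun z _ => hD z)
        (fun z _ => by rw [norm_fderiv_two_eq_norm_iteratedFDeriv]; exact hK₂ z) convex_univ (mem_univ y) (mem_univ x)
    have h : (fderiv ℝ f x) u - (fderiv ℝ f y) u = ((fderiv ℝ f x - fderiv ℝ f y)) u := rfl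
    rw [h, ← Real.norm_eq_abs]
    exact (ContinuousLinearMap.le_opNorm _ _).trans (mul_le_mul_of_nonneg_right hLip (norm_nonneg _))
  -- expand: D²f(P)[−g1](Sp − g1) + Df(P)[−g2] = −D²f(P)[g1](Sp) + (D²f(P)[g1](g1) − Df(P)[g2]) and subtract the reference (= 0)
  have hexp : (fderiv ℝ (fderiv ℝ f) P (-g1)) (Sp - g1) + (fderiv ℝ f P) (-g2) =
      -((fderiv ℝ (fderiv ℝ f) P g1) Sp) + (((fderiv ℝ (fderiv ℝ f) P g1) g1 - (fderiv ℝ f P) g2) -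
        ((fderiv ℝ (fderiv ℝ f) (-γ φ) g1) g1 - (fderiv ℝ f (-γ φ)) g2)) := by
    rw [href0, sub_zero, map_neg, map_neg, neg_apply, map_sub]; ring
  rw [hexp]
  have t1 : |(fderiv ℝ (fderiv ℝ f) P g1) Sp| ≤ K₂ * m₁ * s₁ :=
    (hB2 P g1 Sp).trans (by gcongr)
  have t2 : |(fderiv ℝ (fderiv ℝ f) P g1) g1 - (fderiv ℝ (fderiv ℝ f) (-γ φ) g1) g1| ≤ K₃ * s₀ * m₁ * m₁ := by
    refine (hB2L P (-γ φ) g1 g1).trans ?_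
    have := mul_le_mul (mul_le_mul_of_nonneg_left hPQ hK₃0) hm₁ (norm_nonneg _) (by positivity)
    exact mul_le_mul this hm₁ (norm_nonneg _) (by positivity)
  have t3 : |(fderiv ℝ f P) g2 - (fderiv ℝ f (-γ φ)) g2| ≤ K₂ * s₀ * m₂ := by
    refine (hB1L P (-γ φ) g2).trans ?_
    exact mul_le_mul (mul_le_mul_of_nonneg_left hPQ hK₂0) hm₂ (norm_nonneg _) (by positivity)
  calc |-((fderiv ℝ (fderiv ℝ f) P g1) Sp) + (((fderiv ℝ (fderiv ℝ f) P g1) g1 - (fderiv ℝ f P) g2) -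
        ((fderiv ℝ (fderiv ℝ f) (-γ φ) g1) g1 - (fderiv ℝ f (-γ φ)) g2))|
      ≤ |(fderiv ℝ (fderiv ℝ f) P g1) Sp| + (|(fderiv ℝ (fderiv ℝ f) P g1) g1 - (fderiv ℝ (fderiv ℝ f) (-γ φ) g1) g1| +
          |(fderiv ℝ f P) g2 - (fderiv ℝ f (-γ φ)) g2|) := by
        refine (abs_add_le _ _).trans ?_
        rw [abs_neg]
        gcongr
        calc |((fderiv ℝ (fderiv ℝ f) P g1) g1 - (fderiv ℝ f P) g2) - ((fderiv ℝ (fderiv ℝ f) (-γ φ) g1) g1 - (fderiv ℝ f (-γ φ)) g2)|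
            = |((fderiv ℝ (fderiv ℝ f) P g1) g1 - (fderiv ℝ (fderiv ℝ f) (-γ φ) g1) g1) - ((fderiv ℝ f P) g2 - (fderiv ℝ f (-γ φ)) g2)| := by ring_nf
          _ ≤ _ := abs_sub _ _
    _ ≤ K₂ * m₁ * s₁ + (K₃ * s₀ * m₁ * m₁ + K₂ * s₀ * m₂) := by gcongr
    _ = K₂ * m₁ * s₁ + (K₃ * m₁ ^ 2 + K₂ * m₂) * s₀ := by ring

end Abstract

end Summit.HubbardSuperconductivity.HubbardSuperconductivity.Theorems.C4a

end
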